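import Summits.Ventures.HodgeRepro2.NonVanishingPetersson
import Summits.Ventures.HodgeRepro2.BallQuotientCompactTransfer
import Summits.Ventures.HodgeRepro2.LevelFiniteIndex

/-!
# The non-vanishing input has positive Petersson norm — from «`Γ₁\𝔹²` compact» alone

Kernel support for the blind cell pub-hodge-repro2 (seat p2): the per-subgroup compactness hypothesis of
`NonVanishingPetersson.lean` collapses to the single arithmetic hypothesis «`Γ₁\𝔹²` is compact» (the
anisotropy of `H`): the subgroup `S' = Γ ⊓ Γ_N` has finite index in `Γ₁` (`Γ` does by the hypothesis
shape, `Γ_N` does by row 54), so `S'\𝔹²` is compact by `BallQuotientCompactTransfer.lean`.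
-/

namespace Summit.Ventures.HodgeRepro2.ShimuraData

open MeasureTheory

variable {K : Type*} [Field K] [NumberField K] [NumberField.IsCMField K]
    {τ₁ : K →+* ℂ} {H : Matrix (Fin 3) (Fin 3) K} {Q : Matrix (Fin 3) (Fin 3) ℂ}
    {𝔪 : Submodule ℤ (Fin 3 → K)}

/-- `Γ₁ ⊆ U(H)(K)`, in the form needed to write down `Γ₁\𝔹²`. -/
theorem shimuraLevelSubgroup_one_subset_unitaryGroup (H : Matrix (Fin 3) (Fin 3) K)
    (𝔪 : Submodule ℤ (Fin 3 → K)) :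
    ((shimuraLevelSubgroup K H 𝔪 1 : Subgroup (GL (Fin 3) K)) : Set (GL (Fin 3) K)) ⊆ unitaryGroup K H :=
  subset_unitaryGroup_of_subset_shimuraLevel (S := shimuraLevelSubgroup K H 𝔪 1) (N := 1)
    (fun _ hγ => by rwa [coe_shimuraLevelSubgroup] at hγ)

/-- The intersection of two subgroups, relative to a third: `(S ⊓ T).subgroupOf L = S.subgroupOf L ⊓ T.subgroupOf L`. -/
theorem inf_subgroupOf_eq {G : Type*} [Group G] (S T L : Subgroup G) :
    (S ⊓ T).subgroupOf L = S.subgroupOf L ⊓ T.subgroupOf L := by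
  ext g
  simp only [Subgroup.mem_subgroupOf, Subgroup.mem_inf]

/-- **The non-vanishing input has positive Petersson norm, assuming only that `Γ₁\𝔹²` is compact.**
Under `NonVanishingInput` and `N > 2`: a torsion-free `S' ⊆ Γ_N` of finite index in `Γ₁`, a holomorphic
weight-3 form `f` for `S'` with `f z₀ ≠ 0`, and a fundamental domain `D` with
`∫_D |f|² (1 − ‖z‖²)^3 dμ_B > 0`. -/
theorem NonVanishingInput.exists_setIntegral_petersson_pos_of_compactSpace (hH : IsHermitianForm K H)
    (hdef : ∀ τ : K →+* ℂ, NumberField.InfinitePlace.mk τ ≠ NumberField.InfinitePlace.mk τ₁ →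
      IsDefiniteAt K τ H)
    (hQ : IsFrame K τ₁ H Q) (h𝔪 : IsLattice K 𝔪) (h : NonVanishingInput K τ₁ H 𝔪 Q) {N : ℕ}
    (hN : 2 < N)
    [CompactSpace (ballQuotient hQ (shimuraLevelSubgroup K H 𝔪 1)
      (shimuraLevelSubgroup_one_subset_unitaryGroup H 𝔪))] :
    ∃ S' : Subgroup (GL (Fin 3) K), ∃ hS' : (S' : Set (GL (Fin 3) K)) ⊆ shimuraLevel K H 𝔪 N,
      IsTorsionFreeSet K (S' : Set (GL (Fin 3) K)) ∧
      (S'.subgroupOf (shimuraLevelSubgroup K H 𝔪 1)).FiniteIndex ∧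
      ∃ f : (Fin 2 → ℂ) → ℂ, IsWeightFor τ₁ Q S' 3 f ∧ DifferentiableOn ℂ f ball₂ ∧
        (∃ z₀ ∈ ball₂, f z₀ ≠ 0) ∧
        ∃ D : Set ball₂, IsBallFundamentalDomain hQ S' (subset_unitaryGroup_of_subset_shimuraLevel hS') D ∧
          0 < ∫ z in D, petersson 3 f (z : Fin 2 → ℂ) ∂bergmanBall := by
  obtain ⟨Γ, ⟨S, T, hSΓ, hT, hST, hfi⟩, f, hf, z₀, hz₀, hne⟩ :=
    NonVanishingInput.exists_isAutomorphicForm_ne_zero hQ h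
  -- `T = Γ₁` as subgroups
  have hT' : T = shimuraLevelSubgroup K H 𝔪 1 := by
    apply SetLike.coe_injective
    rw [hT, coe_shimuraLevelSubgroup]
  subst hT'
  let S' : Subgroup (GL (Fin 3) K) := S ⊓ shimuraLevelSubgroup K H 𝔪 N
  have hS' : (S' : Set (GL (Fin 3) K)) ⊆ shimuraLevel K H 𝔪 N := by
    intro γ hγ
    rw [← coe_shimuraLevelSubgroup]
    exact hγ.2
  have hS'S : (S' : Set (GL (Fin 3) K)) ⊆ Γ := by
    intro γ hγ
    rw [← hSΓ]
    exact hγ.1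
  have htf : IsTorsionFreeSet K (S' : Set (GL (Fin 3) K)) :=
    (isTorsionFreeSet_shimuraLevel τ₁ H h𝔪 hN).mono hS'
  have hfw : IsWeightFor τ₁ Q S' 3 f := hf.isWeightFor hS'S
  -- finite index of `S'` in `Γ₁`
  haveI hN1 : ((shimuraLevelSubgroup K H 𝔪 N).subgroupOf (shimuraLevelSubgroup K H 𝔪 1)).FiniteIndex :=
    finiteIndex_subgroupOf_shimuraLevel H 𝔪 h𝔪 (by omega)
  haveI hfi' : (S'.subgroupOf (shimuraLevelSubgroup K H 𝔪 1)).FiniteIndex := by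
    rw [inf_subgroupOf_eq]
    infer_instance
  have hle : S' ≤ shimuraLevelSubgroup K H 𝔪 1 := le_trans inf_le_left hST
  haveI : CompactSpace (ballQuotient hQ S' (subset_unitaryGroup_of_subset_shimuraLevel hS')) :=
    compactSpace_ballQuotient_of_le hQ hle (shimuraLevelSubgroup_one_subset_unitaryGroup H 𝔪)
  obtain ⟨D, hD, hpos⟩ := exists_fundamentalDomain_setIntegral_petersson_pos hH hdef hQ h𝔪 hS' htf
    hfw hf.1.continuousOn hz₀ hne
  exact ⟨S', hS', htf, hfi', f, hfw, hf.1, ⟨z₀, hz₀, hne⟩, D, hD, hpos⟩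

end Summit.Ventures.HodgeRepro2.ShimuraData
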